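import Summits.Ventures.CertifiedManyBodySolver.Observables.SourcedTorusTTPrimeT0AHMEnvelope
import Literature.MathematicalPhysics.QuantumLattice.DWaveSourceApproxSourceLowerBound

/-!
# Bogoliubov Jr.'s approximating-Hamiltonian method for the pair-sourced `t–t'` torus WITH A BASE
# FIELD — the finite-volume SANDWICH (junction of steps (α)(β)(γ)(δ))

Cell `hubbard-cq` (venture `CertifiedManyBodySolver`; transplant-1 DICTIONARY §12 proof chain for the
pair-LRO ceiling, steps (α) hubbard-cq-p1 `ApproximatingHamiltonianGroundEnergy`, (β) hubbard-cq-p3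
`SourcedTorusTTPrime{AHMToolkit,T0AHM,T0AHMEnvelope}`, (γ) hubbard-cq-p4 `DWaveSourcePhaseRotation`,
(δ) hubbard-cq-p1 `DWaveSourceApproxSourceLowerBound`). Notation: `A_L(h) = dWaveSourceTorusTT' L t' U μ h`,
`E_L(h) = E₀(A_L(h))`, `m_L(h) = dWaveSourceDensityTT' L t' U μ h` (sourced `d`-wave pair density per site),
`H_{g,L}(h₀) = A_L(h₀) − (g/L²)Δ_dᴴΔ_d`, `‖P‖ = K_d = 2Σ_e|d(e)/√2|`.

* `ahmTT'_exists_approx_add_sq_le_model` — the hard half in Bogoliubov Jr.'s own (amplitude) form,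
  uniformly in `|μ| ≤ M`, `0 ≤ h₀ ≤ H₀`: `∀ ε > 0 ∃ L₀ ∀ L ≥ L₀ ∃ c ∈ ℂ`,
  `E₀(A_L(h₀) − (c̄W + cWᴴ))/L² + |c|² ≤ E₀(H_{g,L}(h₀))/L² + ε`, `W = √gΔ_d` (the witness is the REAL
  amplitude `c = (h − h₀)/√g` of `ahmTT'_groundEnergy_bound`, via `ahmTT'_approx_real_eq`);
* **`ahmTT'_sandwich`** — THE FINITE-VOLUME `T = 0` AHM SANDWICH with a base field:
  (upper, every `L`, `μ`, `h₀`) `E₀(H_{g,L}(h₀))/L² ≤ E_L(h₀)/L²`;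
  (lower, `∀ ε > 0 ∃ L₀ ∀ L ≥ L₀ ∀ |μ| ≤ M ∀ h₀ ∈ [0, H₀]`)
  `E_L(h₀)/L² − g·m_L(h₀ + 2g‖P‖)² − ε ≤ E₀(H_{g,L}(h₀))/L²` — the hard half composed with p1's (δ2)
  `groundEnergy_dWaveSourceTorusTT'_div_sub_mul_sq_le_approx` (`E_L(h₀)/L² − g·m_L(h₀+2g‖P‖)² ≤
  E₀(approx c)/L² + |c|²` for EVERY `c`);
* `crutchTorusTT'_groundEnergy_sandwich` — the `h₀ = 0` case on the card's D1 object `crutchTorusTT'`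
  (`Observables/CrutchODLROFloor.lean`) by name: the crutch lowers the zero-field ground-state energy
  density by AT MOST `g·m_L(2g‖P‖)² + o(1)` — the energy gain of the BCS crutch is controlled by the
  finite-field RESPONSE at the field `2g‖P‖ = O(g)`.

READING (transplant-1 §12: input of steps (ε)/(ζ); card `bcs-crutch-odlro-floor` BN-T1): in the
thermodynamic limit along any sequence, `e(h₀) − g·limsup m_L(h₀ + 2gK_d)² ≤ liminf e_crutch ≤ limsup
e_crutch ≤ e(h₀)` — the crutch energy density is pinned to the sourced curve within `g × (response)²`.
HONEST SCOPE / WHAT THIS IS NOT: finite torus; `H_{g,L}` is the BCS crutch, NOT the Hubbard model;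
nothing at `g = 0`; no order-parameter floor; no phase sentence. Everything PROVED; no definition, no
named fact; default `DecidableEq (FermionTorus 2 L)` instance.

References: Bogolyubov Jr.–Brankov–Zagrebnov–Kurbatov–Tonchev, Russ. Math. Surveys 39:6 (1984);
Bru–de Siqueira Pedra, Mem. AMS 224 (2013), Appendix, Theorem 107; Koma–Tasaki, J. Stat. Phys. 76
(1994) §1 (sourced pair density).
-/

noncomputable section

namespace Summit.Ventures.CertifiedManyBodySolver.Observables.SourcedTorusAHM

open Matrix Finset Filter Topology Literature.MathematicalPhysics.QuantumLattice
open Literature.Probability.LatticeModels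
open Summit.HubbardSuperconductivity.HubbardSuperconductivity.Theorems
open scoped ComplexOrder Matrix.Norms.L2Operator ComplexConjugate

/-- **Hard half in amplitude form** (Bogoliubov Jr.'s Theorem 107 (ii) shape), uniformly in `|μ| ≤ M`
and `0 ≤ h₀ ≤ H₀`: `∀ ε > 0 ∃ L₀ ∀ L ≥ L₀ ∃ c ∈ ℂ`,
`E₀(A_L(h₀) − (c̄W + cWᴴ))/L² + |c|² ≤ E₀(H_{g,L}(h₀))/L² + ε`, `W = √gΔ_d`; the witness is the real
amplitude `c = (h − h₀)/√g` of `ahmTT'_groundEnergy_bound` (`ahmTT'_approx_real_eq`).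
Bru–de Siqueira Pedra (2013), Theorem 107 (ii). -/
theorem ahmTT'_exists_approx_add_sq_le_model (tp U g M H₀ ε : ℝ) (hg : 0 < g) (hε : 0 < ε) :
    ∃ L₀ : ℕ, ∀ (L : ℕ) [NeZero L], L₀ ≤ L → ∀ μ : ℝ, |μ| ≤ M → ∀ h₀ : ℝ, 0 ≤ h₀ → h₀ ≤ H₀ →
      ∃ c : ℂ,
        (dWaveSourceTorusTT' L tp U μ h₀ -
              (starRingEnd ℂ c • (((Real.sqrt g : ℝ) : ℂ) • pairField dWaveFormFactor L) +
                c • (((Real.sqrt g : ℝ) : ℂ) • pairField dWaveFormFactor L)ᴴ)).groundEnergy /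
            (L : ℝ) ^ 2 + ‖c‖ ^ 2 ≤
          (dWaveSourceTorusTT' L tp U μ h₀ - ((g / (L : ℝ) ^ 2 : ℝ) : ℂ) •
              ((pairField dWaveFormFactor L)ᴴ * pairField dWaveFormFactor L)).groundEnergy /
            (L : ℝ) ^ 2 + ε := by
  obtain ⟨L₀, hL₀⟩ := ahmTT'_groundEnergy_bound tp U g M H₀ ε hg hε
  refine ⟨L₀, fun L _ hL μ hμ h₀ hh₀ hh₀H => ?_⟩
  obtain ⟨h, -, hb⟩ := hL₀ L hL μ hμ h₀ hh₀ hh₀H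
  refine ⟨(((h - h₀) / Real.sqrt g : ℝ) : ℂ), ?_⟩
  rw [ahmTT'_approx_real_eq L tp U μ h₀ h hg, Complex.norm_real, Real.norm_eq_abs, sq_abs, div_pow,
    Real.sq_sqrt hg.le]
  have hV : (0 : ℝ) < (L : ℝ) ^ 2 := cast_sq_pos_of_neZero L
  have e : (dWaveSourceTorusTT' L tp U μ h).groundEnergy + (h - h₀) ^ 2 / g * (L : ℝ) ^ 2 =
      (dWaveSourceTorusTT' L tp U μ h).groundEnergy + (h - h₀) ^ 2 * (L : ℝ) ^ 2 / g := by
    ring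
  have hb' := div_le_div_of_nonneg_right (e.le.trans hb) hV.le
  rwa [add_div, add_div, mul_div_cancel_right₀ _ hV.ne', mul_div_cancel_right₀ _ hV.ne'] at hb'

/-- **The finite-volume `T = 0` approximating-Hamiltonian SANDWICH with a base field** (junction of
(α)(β)(γ)(δ)): (upper, every `L`, `μ`, `h₀`) `E₀(H_{g,L}(h₀))/L² ≤ E_L(h₀)/L²` (easy half at `h = h₀`);
(lower, `∀ ε > 0 ∃ L₀ ∀ L ≥ L₀ ∀ |μ| ≤ M ∀ h₀ ∈ [0, H₀]`)
`E_L(h₀)/L² − g·m_L(h₀ + 2g‖P‖)² − ε ≤ E₀(H_{g,L}(h₀))/L²`, `m_L = dWaveSourceDensityTT'`,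
`‖P‖ = 2Σ_e|d(e)/√2|` — `ahmTT'_exists_approx_add_sq_le_model` composed with hubbard-cq-p1's (δ2)
`groundEnergy_dWaveSourceTorusTT'_div_sub_mul_sq_le_approx`. The crutch term moves the energy density
off the sourced value `E_L(h₀)/L²` by at most `g·m_L(h₀ + 2g‖P‖)² + o(1)`.
Bogolyubov Jr. et al. (1984); Bru–de Siqueira Pedra (2013), Theorem 107; Koma–Tasaki (1994) §1. -/
theorem ahmTT'_sandwich (tp U g M H₀ : ℝ) (hg : 0 < g) :
    (∀ (L : ℕ) [NeZero L] (μ h₀ : ℝ),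
      (dWaveSourceTorusTT' L tp U μ h₀ - ((g / (L : ℝ) ^ 2 : ℝ) : ℂ) •
          ((pairField dWaveFormFactor L)ᴴ * pairField dWaveFormFactor L)).groundEnergy / (L : ℝ) ^ 2 ≤
        (dWaveSourceTorusTT' L tp U μ h₀).groundEnergy / (L : ℝ) ^ 2) ∧
    (∀ ε : ℝ, 0 < ε → ∃ L₀ : ℕ, ∀ (L : ℕ) [NeZero L], L₀ ≤ L → ∀ μ : ℝ, |μ| ≤ M →
      ∀ h₀ : ℝ, 0 ≤ h₀ → h₀ ≤ H₀ →
        (dWaveSourceTorusTT' L tp U μ h₀).groundEnergy / (L : ℝ) ^ 2 -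
              g * dWaveSourceDensityTT' L tp U μ (h₀ + 2 * g *
                (2 * ∑ e ∈ insert (0 : Site 2) unitSteps, |dWaveFormFactor e / Real.sqrt 2|)) ^ 2 -
            ε ≤
          (dWaveSourceTorusTT' L tp U μ h₀ - ((g / (L : ℝ) ^ 2 : ℝ) : ℂ) •
              ((pairField dWaveFormFactor L)ᴴ * pairField dWaveFormFactor L)).groundEnergy /
            (L : ℝ) ^ 2) := by
  refine ⟨fun L _ μ h₀ => ?_, fun ε hε => ?_⟩
  · have h1 := ahmTT'_groundEnergy_model_le L tp U μ h₀ h₀ hg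
    rw [sub_self, zero_pow two_ne_zero, zero_mul, zero_div, add_zero] at h1
    exact div_le_div_of_nonneg_right h1 (cast_sq_pos_of_neZero L).le
  · obtain ⟨L₀, hL₀⟩ := ahmTT'_exists_approx_add_sq_le_model tp U g M H₀ ε hg hε
    refine ⟨L₀, fun L _ hL μ hμ h₀ hh₀ hh₀H => ?_⟩
    obtain ⟨c, hc⟩ := hL₀ L hL μ hμ h₀ hh₀ hh₀H
    have hδ := groundEnergy_dWaveSourceTorusTT'_div_sub_mul_sq_le_approx L tp U μ hh₀ hg c
    linarith

/-- **The sandwich on the card's D1 object `crutchTorusTT'` (`h₀ = 0`), by name**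
(`Observables/CrutchODLROFloor.lean`, card `bcs-crutch-odlro-floor`): (upper, every `L`, `μ`)
`E₀(crutchTorusTT' L t' U μ g)/L² ≤ E₀(A_L(0))/L²`; (lower, `∀ ε > 0 ∃ L₀ ∀ L ≥ L₀ ∀ |μ| ≤ M`)
`E₀(A_L(0))/L² − g·m_L(2g‖P‖)² − ε ≤ E₀(crutchTorusTT' L t' U μ g)/L²`: the BCS crutch lowers the
zero-field ground-state energy density by at most `g·(pair response at field 2g‖P‖)² + o(1)`.
Bogolyubov Jr. et al. (1984); Bru–de Siqueira Pedra (2013), Theorem 107. -/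
theorem crutchTorusTT'_groundEnergy_sandwich (tp U g M : ℝ) (hg : 0 < g) :
    (∀ (L : ℕ) [NeZero L] (μ : ℝ),
      (crutchTorusTT' L tp U μ g).groundEnergy / (L : ℝ) ^ 2 ≤
        (dWaveSourceTorusTT' L tp U μ 0).groundEnergy / (L : ℝ) ^ 2) ∧
    (∀ ε : ℝ, 0 < ε → ∃ L₀ : ℕ, ∀ (L : ℕ) [NeZero L], L₀ ≤ L → ∀ μ : ℝ, |μ| ≤ M →
      (dWaveSourceTorusTT' L tp U μ 0).groundEnergy / (L : ℝ) ^ 2 -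
            g * dWaveSourceDensityTT' L tp U μ (2 * g *
              (2 * ∑ e ∈ insert (0 : Site 2) unitSteps, |dWaveFormFactor e / Real.sqrt 2|)) ^ 2 -
          ε ≤
        (crutchTorusTT' L tp U μ g).groundEnergy / (L : ℝ) ^ 2) := by
  obtain ⟨hup, hlow⟩ := ahmTT'_sandwich tp U g M 0 hg
  refine ⟨fun L _ μ => ?_, fun ε hε => ?_⟩
  · rw [crutchTorusTT'_eq_model]
    exact hup L μ 0
  · obtain ⟨L₀, hL₀⟩ := hlow ε hε
    refine ⟨L₀, fun L _ hL μ hμ => ?_⟩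
    have h1 := hL₀ L hL μ hμ 0 le_rfl le_rfl
    rw [zero_add] at h1
    rw [crutchTorusTT'_eq_model]
    exact h1

end Summit.Ventures.CertifiedManyBodySolver.Observables.SourcedTorusAHM

end
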